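import Literature.NumberTheory.Automorphic.Liu2021.Sec13RelativeFundamentalLemma
import HarnessLib

/-!
# ED.3 — review-class fix from the squad RETRO-AUDIT (TL-t11 g2, 2026-09-02T03:30Z, rule L5 «results vs hypotheses»)

ED.1/ED.2 carried `RZDictionary.LatticeFactsAsPrinted : Prop` — «`Λ_n` is a lattice spanning `V_n^-`, `Λ_n ⊆ Λ_n^*`, and the
determinant of `V_n^-` has odd valuation» (p. 14 L5–13) — as a CLOSED named fact over the dictionary's FREE REAL fields `Lambda`,
`Vminus`.  In print these sentences are properties of the SPECIFIC objects `Λ_n := Hom_k((𝕏_{0k}, i_{0k}), (𝕏_n, i_n))` and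
`V_n^- := (Λ_n)_ℚ`, which this file can only POSIT; over free data they are a consistency clause on what the consumer supplies
(true or false per dictionary, never dischargeable), not the printed result.  ED.3 therefore records them as the Prop FIELDS
`RZDictionary.lambda_fg`, `.lambda_span_eq_top`, `.lambda_le_dual`, `.vminus_parity` (hypotheses the consumer sees — squad rule
L5 / D-0026 (iv)); the def `LatticeFactsAsPrinted` is KEPT with its statement byte-unchanged (append-only norms), is now exactly
the conjunction of those fields, and is DISCHARGED by `theorem LatticeFactsAsPrinted_holds` in the sibling proof file
`Sec13ArithmeticFundamentalLemmaHolds.lean` (kernel lane, filed once this edition lands; this carpet stays statements-only; nothing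
deleted or renamed; squad ruling TL-plan g2-3 (3), option (ii)).  With `vminus_parity` a field, `Item112AsPrinted R` and the Remark 1.13/1.14 facts now speak about a space
that IS `V_n^-` (odd determinant valuation), as printed.  The structure stays inhabited for `n ≥ 1`: Gram matrix `diag(ϖ, 1, …, 1)`,
`Λ = O_E^n` (home scratch witness `T/LIU/TL-t11/g2/RZDictionaryWitness.lean`, not shipped; print: «`n` … an arbitrary positive
integer», p. 11 L48).  Also ED.3: the docstring of `AFLIdentity` records that the predicate does not itself assert differentiability
of `s ↦ Orb(s; …)` at `0` (T-ref4 QA-20 NB n38).  Every other declaration is byte-identical to ED.2 (p848236).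

STATUS SINCE 2026-09-02T03:33Z (squad ruling TL-plan g2-3 (1) on T-ref4 QA-20, superseding the ED.2 note below): for the RELATIVE side
of [Liu2021] §1.2–§1.4 (`S_n`, `M_n`, regular semisimple pairs, transfer factor, actions, sign, matching, orbital integrals, items
1.9 / 1.10 / 1.12 / 1.13 / 1.14) and for item 1.15 the CANONICAL names are this seat's REAL typing — ★ `Sec13RelativeFundamentalLemma`,
this file, ★ `Sec1Introduction`; ★ `Sec13to16IntroductionAFL` (`Sec13Data`) stays canonical for `Sec14Data` / `Sec15Data` and the
RZ-side tokens (`FormalSub`, `specialDivisor`, `chiInt`), its overlapping §1.3 declarations being kept for their two importers but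
superseded; NEW files cite this vocabulary for §1.3 objects (importing this file is allowed), existing consumers migrate at their
next substantive edition.  The correspondence table below is kept as the dictionary between the two typings.
-/

/-!
# ED.2 — PARALLEL TYPING of [Liu2021] §1.3 (Definition 1.11, item 1.12, Remarks 1.13–1.14) — (status superseded by the ED.3 note above)

ED.2 text (2026-09-02T02:45Z), kept for the record: «The vocabulary OF RECORD for [Liu2021] §1.3–§1.6 is ★
`Literature/NumberTheory/Automorphic/Liu2021/Sec13to16IntroductionAFL.lean` (`…Sec13to16IntroductionAFL.Sec13Data` and its
predicates; squad TL typer TL-t02, p847973, landed 2026-09-02T02:26Z; Appendix A of record: ★ `AppendixA/AFLMinusculeCase.lean`,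
TL-t14, which EXTENDS `Sec13Data`).  Consumers import that file and cite its names; no file may import this one or its import
`Sec13RelativeFundamentalLemma` (squad ruling TL-plan 2026-09-02T02:41:42Z)» — REVERSED for the relative side by ruling g2-3 (1),
see above.  This file (typer TL-t11, p848198) was typed in parallel from the same pages after a re-deal crossed the typer's dedup
census and landed on the statement-only lane, as a second rendering (REAL `V_n^-`, `Λ_n` in coordinates; ⟨CARRIER⟩ `𝒩_n(S)` with
Def. 1.11 as a DEFINITION over it) of the SAME printed sentences; it asserts nothing the other file does not.  Declaration ↦
declaration of the other typing (`Sec13Data.*`):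

| this file (`Sec13ArithmeticFundamentalLemma.`) | the other typing (`Sec13to16IntroductionAFL.`) |
|---|---|
| `RZDictionary` (`Vminus`, `Lambda`, `TestSch`, `Npts`, `Extends`, `actN`, `eulerChar`) | fields `Sec13Data.V false`, `.herm`, `.U false`, `.FormalSub`, `.specialDivisor`, `.chiInt` |
| `RZDictionary` hypothesis fields `lambda_fg`, `lambda_span_eq_top`, `lambda_le_dual`, `vminus_parity` (ED.3) and their conjunction `RZDictionary.LatticeFactsAsPrinted` (discharged in the sibling `…Holds.lean`) | — (the `Λ_n ⊆ Λ_n^*` / odd-valuation sentences are recorded in the docstring of `Sec13Data`) |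
| `RZDictionary.Z` (Def. 1.11 as a definition over the dictionary) | field `Sec13Data.specialDivisor` (⟨CARRIER⟩ `𝒵_n(x)`) |
| `RZDictionary.AFLIdentity`, `RZDictionary.Item112AsPrinted` | `Sec13Data.Item112AsPrinted` (+ `Sec13Data.AFLLeftOrbitInvariant` for l. 944) |
| `RZDictionary.Rem113_1AsPrinted` | `Sec13Data.Rem113_1` |
| `RZDictionary.Rem113_2AsPrinted` (READING Q1 for «`F = ℚ_p`») | `Sec13Data.Rem113_2` (field `IsQp`), `Sec13Data.Rem113_equiv` (field `ZhangAFL`) |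
| `IsMinuscule` (REAL lattice condition) | field `Sec13Data.IsMinuscule` (⟨CARRIER⟩) |
| `Rem114AsPrinted` | `Sec13Data.Rem114`; Appendix A's Thm. A.7 in ★ `AppendixA/AFLMinusculeCase.lean` |

Statements are byte-identical to ED.1 (p848198); this edition changes the module docstring only.  (ED.3: see the note above —
`RZDictionary` gained four hypothesis fields whose conjunction is `LatticeFactsAsPrinted`.)
-/

/-!
# Liu 2021, §1.3 «Arithmetic fundamental lemma for U(n) × U(n)», file 3 of 3 of the §1 carpet (print pp. 13–15): the relative
# Rapoport–Zink ⟨CARRIER⟩ dictionary (`𝒩_n`, `Λ_n`, `V_n^-`), Definition 1.11 (`𝒵_n(x)`), item 1.12 (the arithmetic fundamental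
# lemma identity, VOCABULARY PREDICATE), Remark 1.13 (its printed proved cases [Zha12], [Zha21]) and Remark 1.14 (minuscule pairs;
# the case proved in Appendix A by Li–Zhu) — STATEMENTS AS PRINTED (NO proof of anything)

[Liu2021] = Yifeng Liu, *Fourier–Jacobi cycles and arithmetic relative trace formula* (with an appendix by Chao Li and
Yihang Zhu), Cambridge J. Math. **9** (2021), no. 1, 1–147 = arXiv:2102.11518.  PRIMARY SOURCE READ FOR THIS FILE: the
PRINT text held as `paper:liu2021-fourier-jacobi-cycles-arithmetic-relative-trace-formula` (147 pp.; page file `pNNNN` =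
journal page `N`; every «p. N Lk» below is line `k` of that page file), cross-checked against the author's TeX source of
record `FJcycle.tex` (md5 `6db49a74122d…`; every «l. NNNN» below is a line of that file).  §1 = TeX l. 621–1158:
§1.1 l. 625 (p. 3), Thm. 1.1 l. 652 (p. 5 L13), Def. 1.2 l. 676–685 (p. 5 L55 – p. 6 L6), Thm. 1.3 l. 702 (p. 6 L54),
Conj. 1.4 l. 718 (p. 7 L37), Conj. 1.5 l. 740 (p. 8 L8), Rem. 1.6 l. 771 (p. 9 L5), §1.2 l. 776 (p. 9), Thm. 1.7 l. 782
(p. 9 L24), Thm. 1.8 l. 822 (p. 11 L5), §1.3 l. 848–962 (pp. 11–15): set-up l. 853–872 (p. 11 L50 – p. 12 L37), Conj. 1.9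
l. 875–890 (p. 12 L38 – p. 13 L19), Rem. 1.10 l. 892–894 (p. 13 L20), unitary `O_F`-modules and `𝒩_n` l. 896–913 (p. 13
L22 – p. 14 L2), formal special divisors l. 915–921 (p. 14 L3–18), Def. 1.11 l. 923–929 (p. 14 L19–27), `Γ_g` l. 931
(p. 14 L28–33), Conj. 1.12 l. 934–942 (p. 14 L34–49), l. 944 (p. 14 L50–51), Rem. 1.13 l. 946–955 (p. 15 L5–11), Rem. 1.14
l. 959–961 (p. 15 L12–18), §1.4 l. 964 (p. 15), Conj. 1.15 l. 991–996 (p. 16 L9–15) with footnote 3 = l. 986 (p. 16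
L64–65), §1.5 l. 1021 (p. 17), §1.6 l. 1048 (p. 18), §1.7 l. 1090–1158 (pp. 20–21).

This is file 3 of the §1 carpet of squad TL «GO 500» (typer TL-t11).  It imports file 2 ★ `Sec13RelativeFundamentalLemma` (the REAL
local set-up: `AFLSetup`, `HermSpaceLoc`, `Matches`, `sign`, `transferFactor`, `orbIntegral`, `dualSet`, …, and the HONESTY NOTE
on items headed «Conjecture» in print, which applies verbatim to item 1.12 here: in print «Conjecture 1.12 (Arithmetic fundamental
lemma for `U(n) × U(n)`)», a PREDICTED identity, typed ONLY AS VOCABULARY — `AFLIdentity`, `Item112AsPrinted` — so that the printed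
THEOREMS about it, Remark 1.13 (1) [Zha12, Thm. 2.10 & 5.5], (2) [Zha21, Thm. 15.1] and Remark 1.14 (Appendix A, Li–Zhu), can be
stated as named facts; nothing is asserted by the vocabulary; declaration docstrings write «item 1.12» / «[item]» for the printed
heading word, editorial brackets).  File 1 `Sec1Introduction.lean` carries the INDEX of §1.  DEDUP CENSUS (2026-09-02): no
declaration of `lean/Literature` types relative Rapoport–Zink spaces, Kudla–Rapoport divisors `𝒵(x)` or the AFL identity (`lean
search`; the only «Rapoport–Zink» vocabulary is the global uniformization datum of ★ `AppendixC.SecC4IntegralModelsUniformization`,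
a different object) — GREEN FIELD.

## Contents (paper order)

1. `RZDictionary` (REAL `V_n^- = (Λ_n)_ℚ` in coordinates and `Λ_n`; ⟨CARRIER⟩ `𝒩_n(S)`, the extension condition, `g : 𝒩_n → 𝒩_n`,
   `χ(𝒪_{Γ_g} ⊗^𝕃 𝒪_{Δ𝒵_n(x)})`, READING Z1; the printed lattice facts of p. 14 L5–13 as HYPOTHESIS FIELDS, READING Z2, ED.3),
   Definition 1.11 = `RZDictionary.Z` (a DEFINITION over the dictionary), `LatticeFactsAsPrinted` (the conjunction of the hypothesis
   fields; its one-line discharge is the sibling proof file `Sec13ArithmeticFundamentalLemmaHolds.lean`).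
2. Item 1.12: `AFLIdentity` (one pair), `Item112AsPrinted` (VOCABULARY PREDICATE); Remark 1.13: `Rem113_1AsPrinted`, `Rem113_2AsPrinted`
   (READING Q1); Remark 1.14: `IsMinuscule` (REAL), `Rem114AsPrinted` (Appendix A's own statements — the lattice-counting form of the
   derivative, §A.1–A.2 — are the business of the sibling carpet `AppendixA/AFLMinusculeCase.lean`, squad typer TL-t14).

## The printed text (verbatim from `FJcycle.tex`; `\cN` = `𝒩`, `\cZ` = `𝒵`, `\bbX` = `𝕏`, `\breve E` = `Ĕ`, `\CF` = `𝟙`, `\Orb` = `Orb`)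

**Unitary `O_F`-modules, `𝒩_n`, `Λ_n`, `V_n^-`** (l. 896–921, p. 13 L22 – p. 14 L18): «For an `O_Ĕ`-scheme `S`, a *unitary
`O_F`-module of signature `(r, s)`* with integers `r, s ≥ 0` is a triple `(X, i, λ)`, in which • `X` is a strict `O_F`-module over
`S` of dimension `r + s` and `O_F`-height `2(r + s)` over `S`, • `i : O_E → End_S(X)` is an action compatible with the `O_F`-module
structure satisfying that for every `e ∈ O_E` the characteristic polynomial of `i(e)` on `Lie_S(X)` is given by `(T − a^c)^r (T −
a)^s ∈ 𝒪_S[T]`, • `λ : X → X^∨` is a principal polarization such that the associated Rosati involution induces the conjugation on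
`O_E`. […] We fix a supersingular unitary `O_F`-module `(𝕏_0, i_0, λ_0)` of signature `(1, 0)` over `O_Ĕ` […]. For every integer
`n ≥ 1`, we also choose a supersingular unitary `O_F`-module `(𝕏_n, i_n, λ_n)` of signature `(n−1, 1)` over `k` […]. Let `𝒩_n` be
the relative Rapoport–Zink space parameterizing quasi-isogenies of `(𝕏_n, i_n, λ_n)` of height zero. More precisely, it is a formal
scheme over `O_Ĕ` such that for every scheme `S` over `O_Ĕ` on which `p` is locally nilpotent, `𝒩_n(S)` is the set of isomorphism
classes of quadruples `(X, i, λ; ρ)`, where • `(X, i, λ)` is a unitary `O_F`-module over `S` of signature `(n − 1, 1)`, • `ρ : X ×_S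
S_k → 𝕏_n ×_k S_k` is an `O_E`-linear quasi-isogeny (of height zero), such that `ρ^* λ_n = λ`. Here, we put `S_k := S ⊗_{O_Ĕ} k`.
It is known that `𝒩_n` is formally smooth over `O_Ĕ` of relative dimension `n − 1`. See [Mih20, Section 3.1] for more details.
We recall the notion of formal special divisors from [KR11]. Put `Λ_n := Hom_k((𝕏_{0k}, i_{0k}), (𝕏_n, i_n))` and `V_n^- :=
(Λ_n)_ℚ`. Then `V_n^-` is an `E`-vectors space of rank `n` equipped with a hermitian form `(x, y) = i_{0k}^{−1}(λ_{0k}^{−1} ∘ y^∨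
∘ λ_n ∘ x) ∈ E`. If we denote by `Λ_n^*` the dual lattice of `Λ_n` under the above hermitian form, then we have `Λ_n ⊆ Λ_n^*`
and that the length of the `O_E`-module `Λ_n^*/Λ_n` is odd. In particular, the determinant of `V_n^-` has odd valuation,
justifying its notation.»

**Definition 1.11** (l. 923–929, p. 14 L19–27): «For every `x ∈ V_n^-` that is nonzero, we define `𝒵_n(x)` to be the subfunctor
of `𝒩_n` such that for every scheme `S` over `O_Ĕ` on which `p` is locally nilpotent, `𝒵_n(x)(S)` consists of `(X, i, λ; ρ)`
satisfying that the composite homomorphism `𝕏_{0k} ×_k S_k —x→ 𝕏_n ×_k S_k —ρ⁻¹→ X ×_S S_k` extends to an `O_E`-linear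
homomorphism `𝕏_0 ×_{O_Ĕ} S → X` over `S`.»  **l. 931** (p. 14 L28–33): «By [RZ96, Proposition 2.9], `𝒵_n(x)` is a closed
sub-formal scheme of `𝒩_n`. For every `g ∈ U(V_n)(F)`, let `ρ_g : 𝕏_n → 𝕏_n` be the unique `O_E`-linear quasi-isogeny (of height
zero) such that `gx = ρ_g ∘ x` for every `x ∈ V_n`; and, by abuse of notation, let `g : 𝒩_n → 𝒩_n` be the (auto)morphism sending
`(X, i, λ; ρ)` to `(X, i, λ; ρ_g ∘ ρ)`. We denote by `Γ_g ⊆ 𝒩_n^2 := 𝒩_n ×_{O_Ĕ} 𝒩_n` the graph of `g`.»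

**Conjecture 1.12** (arithmetic fundamental lemma; l. 934–942, p. 14 L34–49): «For every regular semisimple orbit `(ζ, y) ∈
[S_n(F) × M_n(F)]^-_rs`, we have `−ω(ζ, y) (d/ds)|_{s=0} Orb(s; 𝟙_{S_n(O_F)}, 𝟙_{M_n(O_F)}; ζ, y) = 2 log q · χ(𝒪_{Γ_ξ}
⊗^𝕃_{𝒪_{𝒩_n^2}} 𝒪_{Δ𝒵_n(x)})`, where `(ξ, x) ∈ [U(V_n^-)(F) × V_n^-(E)]_rs` is the unique orbit that matches `(ζ, y)`, and `χ`
denotes the Euler–Poincaré characteristic.»  **l. 944** (p. 14 L50–51): «In Conjecture 1.12, it follows from Conjecture 1.9(1),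
which is known, that the left-hand side depends only on the `GL_n(F)`-orbit of `(ζ, y)`.»

**Remark 1.13** (l. 946–955, p. 15 L5–11): «During the referee process of this article, Wei Zhang [Zha21, Proposition 4.12 &
Remark 3.1] has shown that his arithmetic fundamental lemma for `U(n) × U(n+1)` is equivalent to our arithmetic fundamental lemma
for `U(n) × U(n)` (with respect to the same field extension `E/F`) when the residue cardinality of `F` is greater than `n`. In
particular, we find (1) Conjecture 1.12 holds when `n ≤ 2` and `q` is odd, by [Zha12, Theorem 2.10 & Theorem 5.5]. (2)
Conjecture 1.12 holds when `F = ℚ_p` with `p > n`, by [Zha21, Theorem 15.1].»  **Remark 1.14** (l. 959–961, p. 15 L12–18): «In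
Section A, Chao Li and Yihang Zhu proved Conjecture 1.12 (for arbitrary `E/F`) in the so-called minuscule case, similar to the case
of `U(n) × U(n+1)`. In the case of `U(n) × U(n)`, we say that a regular semisimple pair `(ξ, x) ∈ U(V_n^-)(F) × V_n^-(E)` is
*minuscule* if the `O_E`-lattice `L_{ξ,x}` generated by `{x, ξx, ⋯, ξ^{n−1}x}` satisfies `ϖ L_{ξ,x}^* ⊆ L_{ξ,x} ⊆ L_{ξ,x}^*` where `ϖ`
is a uniformizer of `F` and `L_{ξ,x}^*` denotes the dual lattice.»

## The typing and its READINGS (those of file 2 — L1, M1, S1, H1, F1, U1 — apply; in addition)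

* **Z1** (the relative RZ side).  Strict `O_F`-modules, quasi-isogenies, formal schemes and `χ(− ⊗^𝕃 −)` are not in Mathlib:
  `RZDictionary` posits `𝒩_n(S)` (a type per test object `S`), the EXTENSION CONDITION of Def. 1.11 (a predicate on `𝒩_n(S) × V_n^-`),
  the automorphism `g : 𝒩_n → 𝒩_n`, and the intersection number `χ(𝒪_{Γ_g} ⊗^𝕃 𝒪_{Δ𝒵_n(x)}) ∈ ℤ ∪ {∞}` as ⟨CARRIER⟩s, next to the
  REAL `V_n^-` (coordinates, READING H1) and `Λ_n ⊆ V_n^-` (an `O_E`-submodule of `E^n`); Def. 1.11 is then a DEFINITION with a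
  body (`RZDictionary.Z`).  «`F = ℚ_p` with `p > n`» (Rem. 1.13 (2)) ↦ READING **Q1**: `q` is prime, `q · 1_F` is a uniformizer
  (`ord F q = 1`) and `n < q` (for a finite extension `F/ℚ_p`: `F = ℚ_p` iff `f = e = 1`).  «`p` sufficiently large» (Rem. 1.10 (2))
  is READING P1 of file 2.
* **Z2** (ED.3; the printed facts about `Λ_n`, `V_n^-`, p. 14 L5–13).  «`V_n^- := (Λ_n)_ℚ` […] is an `E`-vectors space of rank `n`»,
  «we have `Λ_n ⊆ Λ_n^*`» and «the determinant of `V_n^-` has odd valuation» are properties of the specific `Λ_n`, `V_n^-` of the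
  source; over the dictionary's free REAL fields they are HYPOTHESIS FIELDS (`lambda_fg`, `lambda_span_eq_top`, `lambda_le_dual`,
  `vminus_parity`), and the ED.1 def `LatticeFactsAsPrinted` (their conjunction, statement unchanged) follows from them (proof file
  `Sec13ArithmeticFundamentalLemmaHolds.lean`); «the length of the `O_E`-module `Λ_n^*/Λ_n` is odd» is recorded, not typed (its printed consequence,
  the odd valuation of the determinant, is the field `vminus_parity`).
NO PROOF anywhere (statements only).

## NOT here

The formal schemes `𝒩_n`, `𝒵_n(x)` as geometric objects and the two cited facts about them ([Mih20, §3.1], [RZ96, Prop. 2.9]);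
unitary `O_F`-modules `(X, i, λ)` as objects (quoted above, entering only the ⟨CARRIER⟩ `RZDictionary.Npts`); Appendix A (Li–Zhu)
itself; proofs.

## References

* [Liu2021] Y. Liu, *Fourier–Jacobi cycles and arithmetic relative trace formula*, Camb. J. Math. 9 (2021) 1–147, arXiv:2102.11518
  — §1 pp. 3–21 (pins above); App. A p. 90 L33, p. 92 L6 (READING M1); App. C l. 4558 (READING H1); Def. 4.1 p. 41.
* [ZhangWei2012AFL] W. Zhang, *On arithmetic fundamental lemmas*, Invent. Math. 188 (2012) 197–252 — Thm. 2.10, Thm. 5.5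
  (Rem. 1.13 (1)) = [Zha12].
* [ZhangWei2021WeilAFL] W. Zhang, *Weil representation and arithmetic fundamental lemma*, Ann. of Math. 193 (2021) — Prop. 4.12,
  Rem. 3.1, Thm. 15.1 (Rem. 1.13) = [Zha21].
* [KudlaRapoport2011SpecialCyclesI] S. Kudla, M. Rapoport, *Special cycles on unitary Shimura varieties I*, Invent. Math. 184
  (2011) = [KR11]; [RapoportZink1996] M. Rapoport, Th. Zink, *Period spaces for p-divisible groups*, Prop. 2.9 = [RZ96];
  [Mih20] A. Mihatsch, *Relative unitary RZ-spaces and the arithmetic fundamental lemma*, §3.1 — quoted, not used.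
-/

noncomputable section

open MeasureTheory Matrix
open scoped ValuativeRel
open Literature.NumberTheory.Automorphic.Liu2021.Sec13RelativeFundamentalLemma
open Literature.NumberTheory.Automorphic.Liu2021.Sec13RelativeFundamentalLemma.AFLSetup

namespace Literature.NumberTheory.Automorphic.Liu2021.Sec13ArithmeticFundamentalLemma

variable {F E : Type} [Field F] [ValuativeRel F] [TopologicalSpace F] [IsNonarchimedeanLocalField F]
  [Field E] [ValuativeRel E] [TopologicalSpace E] [IsNonarchimedeanLocalField E] [Algebra F E] [ValuativeExtension F E]


variable (S : AFLSetup F E) (n : ℕ)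

/-! ## Item 1: the relative Rapoport–Zink dictionary (pp. 13–14) and Definition 1.11 (p. 14) -/

/-- **⟨CARRIER⟩ dictionary for the relative Rapoport–Zink space `𝒩_n`** (p. 13 L22 – p. 14 L33; l. 896–931), READING Z1, next to the
REAL hermitian space `V_n^-` and lattice `Λ_n` (see the module docstring for the verbatim text).  Fields:
* `Vminus` — REAL: «`V_n^- := (Λ_n)_ℚ` […] an `E`-vectors space of rank `n` equipped with a hermitian form `(x, y) = i_{0k}^{−1}(λ_{0k}^{−1}
  ∘ y^∨ ∘ λ_n ∘ x)`», in coordinates (READING H1);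
* `Lambda` — REAL: «`Λ_n := Hom_k((𝕏_{0k}, i_{0k}), (𝕏_n, i_n))`» as an `O_E`-submodule of `V_n^- = E^n`;
* `TestSch` — ⟨CARRIER⟩ «schemes `S` over `O_Ĕ` on which `p` is locally nilpotent»;
* `Npts S` — ⟨CARRIER⟩ «`𝒩_n(S)`, the set of isomorphism classes of quadruples `(X, i, λ; ρ)`» (a unitary `O_F`-module of signature
  `(n−1, 1)` over `S` with a height-zero `O_E`-linear quasi-isogeny `ρ : X ×_S S_k → 𝕏_n ×_k S_k`, `ρ^*λ_n = λ`);
* `Extends P x` — ⟨CARRIER⟩ the condition of Def. 1.11 for `P = (X, i, λ; ρ) ∈ 𝒩_n(S)` and `x ∈ V_n^-`: «the composite homomorphism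
  `𝕏_{0k} ×_k S_k —x→ 𝕏_n ×_k S_k —ρ⁻¹→ X ×_S S_k` extends to an `O_E`-linear homomorphism `𝕏_0 ×_{O_Ĕ} S → X` over `S`»;
* `actN g` — ⟨CARRIER⟩ «`g : 𝒩_n → 𝒩_n`, the (auto)morphism sending `(X, i, λ; ρ)` to `(X, i, λ; ρ_g ∘ ρ)`» for `g ∈ U(V_n^-)(F)`, on
  `S`-points;
* `eulerChar g x` — ⟨CARRIER⟩ «`χ(𝒪_{Γ_g} ⊗^𝕃_{𝒪_{𝒩_n^2}} 𝒪_{Δ𝒵_n(x)})`», the Euler–Poincaré characteristic (§1.7, p. 21 L42–48: `χ(ℱ) := Σ_i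
  (−1)^i length H^i ℱ` if of finite length, `∞` otherwise — valued in `WithTop ℤ`) of the derived intersection on `𝒩_n^2 := 𝒩_n
  ×_{O_Ĕ} 𝒩_n` of the graph `Γ_g` with the diagonal image of `𝒵_n(x)` (Def. 1.11, `RZDictionary.Z`).
Recorded, not typed (formal schemes): «`𝒩_n` is formally smooth over `O_Ĕ` of relative dimension `n − 1`» ([Mih20, §3.1]); «`𝒵_n(x)`
is a closed sub-formal scheme of `𝒩_n`» ([RZ96, Prop. 2.9]).
HYPOTHESIS FIELDS (ED.3, READING Z2 — the printed properties of the specific `Λ_n`, `V_n^-`, p. 14 L5–13, which over the free REAL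
fields above are hypotheses on the consumer's data, not results): `lambda_fg` and `lambda_span_eq_top` («`V_n^- := (Λ_n)_ℚ` […] is an
`E`-vectors space of rank `n`»: `Λ_n` is a finitely generated `O_E`-submodule spanning `E^n`), `lambda_le_dual` («we have `Λ_n ⊆
Λ_n^*`», the dual under the hermitian form, `dualSet`), `vminus_parity` («the determinant of `V_n^-` has odd valuation»: `parity V_n^- =
−1`; this forces `n ≥ 1`, as in print, p. 11 L48 «`n` … an arbitrary positive integer»).  «The length of the `O_E`-module `Λ_n^*/Λ_n` is
odd» is recorded, not typed.  Nothing else is asserted by this structure.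
[cite: Liu2021, §1.3 (pp. 13–14); Def. 1.11 (p. 14)] -/
structure RZDictionary (S : AFLSetup F E) (n : ℕ) : Type 1 where
  /-- REAL «`V_n^- := (Λ_n)_ℚ`» with its hermitian form, in coordinates. -/
  Vminus : HermSpaceLoc S n
  /-- REAL «`Λ_n := Hom_k((𝕏_{0k}, i_{0k}), (𝕏_n, i_n))`» inside `V_n^-`. -/
  Lambda : Submodule 𝒪[E] (Fin n → E)
  /-- hypothesis (p. 14 L5–6, «`V_n^- := (Λ_n)_ℚ`»): `Λ_n` is a finitely generated `O_E`-module … -/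
  lambda_fg : Lambda.FG
  /-- … spanning `V_n^- = E^n` over `E` («an `E`-vectors space of rank `n`»). -/
  lambda_span_eq_top : Submodule.span E (Lambda : Set (Fin n → E)) = ⊤
  /-- hypothesis (p. 14 L9–10): «we have `Λ_n ⊆ Λ_n^*`» (dual lattice under the hermitian form of `V_n^-`). -/
  lambda_le_dual : (Lambda : Set (Fin n → E)) ⊆ dualSet Vminus Lambda
  /-- hypothesis (p. 14 L11–13): «the determinant of `V_n^-` has odd valuation». -/
  vminus_parity : Vminus.parity = -1
  /-- ⟨CARRIER⟩ schemes `S` over `O_Ĕ` on which `p` is locally nilpotent. -/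
  TestSch : Type
  /-- ⟨CARRIER⟩ «`𝒩_n(S)`». -/
  Npts : TestSch → Type
  /-- ⟨CARRIER⟩ the extension condition of Def. 1.11 for a point of `𝒩_n(S)` and `x ∈ V_n^-`. -/
  Extends : ∀ {T : TestSch}, Npts T → (Fin n → E) → Prop
  /-- ⟨CARRIER⟩ «`g : 𝒩_n → 𝒩_n`», `(X, i, λ; ρ) ↦ (X, i, λ; ρ_g ∘ ρ)`, on `S`-points. -/
  actN : Vminus.U → ∀ {T : TestSch}, Npts T → Npts T
  /-- ⟨CARRIER⟩ «`χ(𝒪_{Γ_g} ⊗^𝕃_{𝒪_{𝒩_n^2}} 𝒪_{Δ𝒵_n(x)})`» (`∞` allowed, §1.7). -/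
  eulerChar : Vminus.U → (Fin n → E) → WithTop ℤ

namespace RZDictionary

variable {S n} (R : RZDictionary S n)

/-- **[Liu2021, Definition 1.11] AS PRINTED** (p. 14 L19–27; l. 923–929): «For every `x ∈ V_n^-` that is nonzero, we define `𝒵_n(x)` to
be the subfunctor of `𝒩_n` such that for every scheme `S` over `O_Ĕ` on which `p` is locally nilpotent, `𝒵_n(x)(S)` consists of `(X, i,
λ; ρ)` satisfying that the composite homomorphism `𝕏_{0k} ×_k S_k —x→ 𝕏_n ×_k S_k —ρ⁻¹→ X ×_S S_k` extends to an `O_E`-linear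
homomorphism `𝕏_0 ×_{O_Ĕ} S → X` over `S`.»  TYPED as a DEFINITION over the dictionary (READING Z1): the `S`-points of `𝒵_n(x)` are the
points of `𝒩_n(S)` satisfying the extension condition (for `x ≠ 0`; the body makes sense for every `x`).
[cite: Liu2021, Def. 1.11 (p. 14)] -/
def Z (x : Fin n → E) (T : R.TestSch) : Set (R.Npts T) :=
  {P | R.Extends P x}

/-- **[Liu2021, §1.3, p. 14 L5–13] AS PRINTED** (l. 919–921): «we have `Λ_n ⊆ Λ_n^*` and that the length of the `O_E`-module `Λ_n^*/Λ_n`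
is odd. In particular, the determinant of `V_n^-` has odd valuation», together with «`V_n^-` is an `E`-vectors space of rank `n`»
realized by `Λ_n` (p. 14 L5–6: `V_n^- = (Λ_n)_ℚ`, i.e. `Λ_n` is a lattice spanning `V_n^-`).  TYPED over the dictionary's REAL `Λ_n`,
`V_n^-`: `Λ_n` is finitely generated and spans `E^n`, `Λ_n ⊆ Λ_n^*`, and `parity V_n^- = −1`; the odd LENGTH of `Λ_n^*/Λ_n` is recorded,
not typed (its printed consequence, the odd valuation of the determinant, is).  ED.3 (READING Z2): these four clauses are properties
of the SPECIFIC `Λ_n`, `V_n^-` of the source, hence HYPOTHESIS FIELDS of `RZDictionary` (`lambda_fg`, `lambda_span_eq_top`,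
`lambda_le_dual`, `vminus_parity`); this def (statement byte-unchanged since ED.1) is kept for its name and is now exactly their
conjunction — it follows from the fields by `⟨R.lambda_fg, R.lambda_span_eq_top, R.lambda_le_dual, R.vminus_parity⟩`; the discharge
`theorem LatticeFactsAsPrinted_holds` lives in the sibling PROOF file `Sec13ArithmeticFundamentalLemmaHolds.lean` (kernel lane; this
carpet stays statements-only) — no longer a free-standing named fact. [cite: Liu2021, §1.3 (p. 14)] -/
def LatticeFactsAsPrinted : Prop :=
  R.Lambda.FG ∧ Submodule.span E (R.Lambda : Set (Fin n → E)) = ⊤ ∧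
    (R.Lambda : Set (Fin n → E)) ⊆ dualSet R.Vminus R.Lambda ∧ R.Vminus.parity = -1

/-! ## Item 2: item 1.12 (p. 14) — VOCABULARY PREDICATE — and Remarks 1.13–1.14 (p. 15) -/

/-- **The identity of [Liu2021, item 1.12] (the arithmetic fundamental lemma identity) for ONE pair** (p. 14 L36–45; l. 935–941): «`−ω(ζ, y) (d/ds)|_{s=0} Orb(s; 𝟙_{S_n(O_F)},
𝟙_{M_n(O_F)}; ζ, y) = 2 log q · χ(𝒪_{Γ_ξ} ⊗^𝕃_{𝒪_{𝒩_n^2}} 𝒪_{Δ𝒵_n(x)})`» for `(ζ, y)` and `(ξ, x) ∈ U(V_n^-)(F) × V_n^-(E)` — TYPED (READINGS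
F1, M1, Z1): the intersection number is FINITE, `= m ∈ ℤ`, and `−ω(ζ, y) · deriv (s ↦ Orb(s; 𝟙, 𝟙; ζ, y)) 0 = 2 log q · m` in `ℂ`.
(ED.3 note, QA-20 n38: the predicate does not itself assert that `s ↦ Orb(s; 𝟙, 𝟙; ζ, y)` is differentiable at `0` — Mathlib's `deriv`
is `0` where it is not; for a regular semisimple pair the orbit is closed with trivial stabilizer, the integrand has compact support
on it and `Orb` is entire, as in print.)  A predicate; nothing asserted. [cite: Liu2021, §1.3 item 1.12 (p. 14)] -/
def AFLIdentity [MeasurableSpace (GL (Fin n) F)] (dg : Measure (GL (Fin n) F)) (ζ : Matrix (Fin n) (Fin n) E) (y : Mn F n)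
    (ξ : R.Vminus.U) (x : Fin n → E) : Prop :=
  ∃ m : ℤ, R.eulerChar ξ x = (m : WithTop ℤ) ∧
    -((S.transferFactor n ζ y : ℤ) : ℂ) *
        deriv (fun s : ℂ => S.orbIntegral n dg s ((S.symmSpaceInt n).indicator fun _ => (1 : ℂ))
          ((S.MnInt n).indicator fun _ => (1 : ℂ)) ζ y) 0 =
      2 * (Real.log (S.q : ℝ) : ℂ) * (m : ℂ)

/-- **[Liu2021, item 1.12] (arithmetic fundamental lemma for `U(n) × U(n)`) — [statement] ONLY, typed as a VOCABULARY PREDICATE (HONESTY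
NOTE; its printed proved cases are `Rem113_1AsPrinted`, `Rem113_2AsPrinted`, `Rem114AsPrinted`)** (p. 14 L34–49; l. 934–942): «For every regular
semisimple orbit `(ζ, y) ∈ [S_n(F) × M_n(F)]^-_rs`, we have `−ω(ζ, y) (d/ds)|_{s=0} Orb(s; 𝟙_{S_n(O_F)}, 𝟙_{M_n(O_F)}; ζ, y) = 2 log q ·
χ(𝒪_{Γ_ξ} ⊗^𝕃_{𝒪_{𝒩_n^2}} 𝒪_{Δ𝒵_n(x)})`, where `(ξ, x) ∈ [U(V_n^-)(F) × V_n^-(E)]_rs` is the unique orbit that matches `(ζ, y)`, and `χ`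
denotes the Euler–Poincaré characteristic.»  TYPED (READINGS S1, U1) over the dictionary `R` (whose `V_n^-` is the space of the
item) and the normalized Haar measure parameter `dg`.  Nothing asserted. [cite: Liu2021, §1.3 item 1.12 (p. 14)] -/
def Item112AsPrinted [MeasurableSpace (GL (Fin n) F)] (dg : Measure (GL (Fin n) F)) : Prop :=
  S.IsNormalizedHaarGL n dg →
    ∀ ζ ∈ S.symmSpace n, ∀ (y : Mn F n), S.IsRegularSemisimple n ζ y → S.sign n ζ y = -1 →
      ∀ (ξ : R.Vminus.U) (x : Fin n → E), IsRegularSemisimpleU R.Vminus ξ x → Matches R.Vminus ζ y ξ x →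
        R.AFLIdentity dg ζ y ξ x

/-- **[Liu2021, Remark 1.13 (1)] AS PRINTED** (p. 15 L10; l. 952): «[item] 1.12 holds when `n ≤ 2` and `q` is odd, by [Zha12,
Theorem 2.10 & Theorem 5.5].» (editorial bracket, HONESTY NOTE).  TYPED over the dictionary: `n ≤ 2 → Odd q → Item112AsPrinted` for every normalized Haar measure
parameter.  Named fact, NO PROOF here ([ZhangWei2012AFL, Thm. 2.10, Thm. 5.5], through the equivalence [ZhangWei2021WeilAFL, Prop.
4.12 & Rem. 3.1] quoted in the remark).  A consumer takes `(h : R.Rem113_1AsPrinted)`.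
[cite: Liu2021, Rem. 1.13 (p. 15)] [cite: ZhangWei2012AFL, Thm. 2.10 and Thm. 5.5] -/
def Rem113_1AsPrinted : Prop :=
  n ≤ 2 → Odd S.q → ∀ [MeasurableSpace (GL (Fin n) F)] (dg : Measure (GL (Fin n) F)), R.Item112AsPrinted dg

/-- **[Liu2021, Remark 1.13 (2)] AS PRINTED** (p. 15 L11; l. 954): «[item] 1.12 holds when `F = ℚ_p` with `p > n`, by [Zha21,
Theorem 15.1].» (editorial bracket, HONESTY NOTE).  TYPED (READING Q1: «`F = ℚ_p`» ↔ `q` is prime and `q · 1_F` is a uniformizer of `F`): `q` prime → `ord F q = 1` →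
`n < q` → `Item112AsPrinted` for every normalized Haar measure parameter.  Named fact, NO PROOF here ([ZhangWei2021WeilAFL, Thm.
15.1]).  A consumer takes `(h : R.Rem113_2AsPrinted)`. [cite: Liu2021, Rem. 1.13 (p. 15)] [cite: ZhangWei2021WeilAFL, Thm. 15.1] -/
def Rem113_2AsPrinted : Prop :=
  (S.q).Prime → ord F (S.q : F) = 1 → n < S.q →
    ∀ [MeasurableSpace (GL (Fin n) F)] (dg : Measure (GL (Fin n) F)), R.Item112AsPrinted dg

end RZDictionary

variable {S n} in
/-- **«minuscule»** ([Liu2021, Remark 1.14], p. 15 L14–18; l. 960–961): «we say that a regular semisimple pair `(ξ, x) ∈ U(V_n^-)(F) ×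
V_n^-(E)` is *minuscule* if the `O_E`-lattice `L_{ξ,x}` generated by `{x, ξx, ⋯, ξ^{n−1}x}` satisfies `ϖ L_{ξ,x}^* ⊆ L_{ξ,x} ⊆ L_{ξ,x}^*`
where `ϖ` is a uniformizer of `F` and `L_{ξ,x}^*` denotes the dual lattice.»  REAL: `L_{ξ,x} = span_{O_E} {ξ^i x}`, `L^* = dualSet`, and
the two inclusions for every uniformizer `ϖ` of `F` (`ord F ϖ = 1`; the condition does not depend on the choice).
[cite: Liu2021, Rem. 1.14 (p. 15)] -/
def IsMinuscule (V : HermSpaceLoc S n) (ξ : V.U) (x : Fin n → E) : Prop :=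
  let L : Submodule 𝒪[E] (Fin n → E) :=
    Submodule.span 𝒪[E] (Set.range fun i : Fin n => (((ξ : GL (Fin n) E) : Matrix (Fin n) (Fin n) E) ^ (i : ℕ)) *ᵥ x)
  (∀ ϖ : F, ord F ϖ = 1 → ∀ y ∈ dualSet V L, (algebraMap F E ϖ) • y ∈ L) ∧ (L : Set (Fin n → E)) ⊆ dualSet V L

variable {S n} in
/-- **[Liu2021, Remark 1.14, first sentence] AS PRINTED** (p. 15 L12–14; l. 959–960): «In Section A, Chao Li and Yihang Zhu proved
[item] 1.12 (for arbitrary `E/F`) in the so-called minuscule case» (editorial bracket, HONESTY NOTE).  TYPED over the dictionary `R` and the normalized Haar measure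
parameter: the identity of Conj. 1.12 holds for every regular semisimple `(ζ, y)` of sign `−` and every MINUSCULE regular semisimple
`(ξ, x)` of `V_n^-` matching it.  Named fact, NO PROOF here (the proof is Appendix A by C. Li and Y. Zhu, pp. 90–95, whose own
statements — lattice-counting form of the derivative, §A.1–A.2 — are typed in the sibling carpet `AppendixA/AFLMinusculeCase.lean`).
A consumer takes `(h : Rem114AsPrinted R dg)`. [cite: Liu2021, Rem. 1.14 (p. 15); App. A (pp. 90–95)] -/
def Rem114AsPrinted (R : RZDictionary S n) [MeasurableSpace (GL (Fin n) F)] (dg : Measure (GL (Fin n) F)) : Prop :=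
  S.IsNormalizedHaarGL n dg →
    ∀ ζ ∈ S.symmSpace n, ∀ (y : Mn F n), S.IsRegularSemisimple n ζ y → S.sign n ζ y = -1 →
      ∀ (ξ : R.Vminus.U) (x : Fin n → E), IsRegularSemisimpleU R.Vminus ξ x → Matches R.Vminus ζ y ξ x →
        IsMinuscule R.Vminus ξ x → R.AFLIdentity dg ζ y ξ x


end Literature.NumberTheory.Automorphic.Liu2021.Sec13ArithmeticFundamentalLemma

end
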